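import Literature.Barriers.CriticalPhenomena.SupercriticalSAWSpaceFillingProofsOnto
import Literature.Probability.RandomPlanarGeometry.SAWSusceptibility
import Mathlib.MeasureTheory.Measure.Lebesgue.VolumeOfBalls
import HarnessLib

/-!
# Subcritical self-avoiding walks are short and thin: the lattice side of the LEFT half of the
# fugacity barrier (`SupercriticalSAWSpaceFilling`, fifth audit of its mechanism file `…Proofs`)

Barrier catalogue `Literature/Barriers/CriticalPhenomena/` (D-0021). The earlier audits of the
mechanism of `SupercriticalSAWSpaceFilling` (= Theorem 1 of H. Duminil-Copin, G. Kozma, A. Yadin,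
*Supercritical self-avoiding walks are space-filling*, Ann. IHP Probab. Stat. 50 (2014) 315–326,
arXiv:1110.3074) machine-checked the RIGHT half of the fugacity axis: for every `x > x_c` the
fugacity-`x` SAW converges to no chordal SLE_κ, `0 < κ < 8` (`…BelowEight`), so an SLE_κ
identification certifies `x ≤ x_c` (`SupercriticalSAW.le_criticalFugacity_of_sawScalingLimitAt`,
`…ProofsOnto`), while LEFT classes `(x_c - ε, x_c]` were "refuted by no declaration of the tree"
(`…ProofsOnto`, item 3; dead in substance by the subcritical Ornstein–Zernike picture
[cite: BetzTaggi2019, §1]). This file supplies the two lattice inputs of the left half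
(`SupercriticalSAWSpaceFillingSubcritical.lean`):

* `tendsto_lawAt_length_lt_of_lt_criticalFugacity` — **subcritical walks are short**: for
  `0 < x < x_c = 1/μ` there is `C = C(x)` such that, for any endpoints `u_δ, v_δ ∈ 𝔻_δ`,
  `P_{(𝔻_δ,u_δ,v_δ,x)}[|γ_δ| > C/δ] → 0` as `δ → 0⁺`. Proof: `Z ≥ x^{4/δ}` (a monotone lattice
  path of `≤ 4/δ` steps joins `u_δ` to `v_δ` through the centre, `exists_domainSAW_length_le`),
  while the weight of the walks of length `≥ N` is at most `Σ_{n ≥ N} cₙ xⁿ ≤ K ρᴺ/(1-ρ)` with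
  `ρ = ρ(x) < 1` (`card_filter_length_eq_le_count`: a SAW of `𝔻_δ` of length `n` from `u` is an
  `n`-step SAW of `ℤ²`; `Zd.exists_bound_count_mul_pow`: `cₙ wⁿ` is bounded for `w < x_c`
  [cite: MadrasSlade1993, §1.2]); with `C log(1/ρ) > 4 log(1/x)` the ratio is `≤ K' e^{-c/δ}`.
* `volume_setOf_infDist_lt_le_of_length_le` — **short walks are thin**: a SAW of `Ω_δ` with
  `|γ| ≤ C/δ` has `vol{w : dist(w, trace γ) < ρ} ≤ 9π(C+1)ρ` for `δ ≤ ρ ≤ 1` (every `k`-th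
  vertex, `k = ⌈ρ/δ⌉`, is the centre of a ball of radius `3ρ`; there are `≤ C/ρ + 1` of them).

Everything is proved; no named facts.

Mathlib: `SimpleGraph.Walk.getVert`, `SimpleGraph.Walk.bypass`, `Finset.sum_fiberwise_of_maps_to`,
`geom_sum_Ico_le_of_lt_one`, `measure_biUnion_finset_le`, `Complex.volume_ball`,
`tendsto_inv_nhdsGT_zero`, `Real.tendsto_exp_neg_atTop_nhds_zero`.

## References

* N. Madras, G. Slade, *The Self-Avoiding Walk*, Birkhäuser (1993), §1.2 (`c_{n+m} ≤ cₙ cₘ`,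
  `μ = lim cₙ^{1/n} = inf cₙ^{1/n}`, so `Σ cₙ xⁿ < ∞` for `x < 1/μ`). [MadrasSlade1993]
* H. Duminil-Copin, G. Kozma, A. Yadin, Ann. IHP Probab. Stat. 50 (2014) 315–326,
  arXiv:1110.3074: §1, "When `x < 1/μ`: `γ_δ` converges to a deterministic curve corresponding
  to the geodesic between `a` and `b` in `Ω`". [DuminilCopinKozmaYadin2014]
* V. Betz, L. Taggi, Electron. J. Probab. 24 (2019), arXiv:1612.07234, §1. [BetzTaggi2019]
-/

noncomputable section

open MeasureTheory Filter Topology Metric Set Literature.Probability.LatticeModels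
  Literature.Probability.Percolation Literature.Probability.RandomPlanarGeometry
  Literature.Probability.RandomPlanarGeometry.SAW
open scoped ENNReal NNReal

namespace Literature.Barriers.CriticalPhenomena

namespace SupercriticalSAW

/-! ### SAWs of `𝔻_δ` of length `n` are `n`-step SAWs of `ℤ²` -/

section Counting

variable {δ : ℝ} {u v : Site 2}

/-- Two SAWs with the same underlying walk are equal. [folklore] -/
theorem DomainSAW.ext_walk {Ω : Set ℂ} {γ γ' : DomainSAW Ω δ u v} (h : γ.walk = γ'.walk) : γ = γ' := by
  cases γ; cases γ'; cases h; rfl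

/-- The vertex function of a SAW of `𝔻_δ` from `u`, translated by `-u`, is an `n`-step
self-avoiding walk of `ℤ²` from `0` (`n = |γ|`), in the sense of `Zd.saws`. [cite: MadrasSlade1993, §1.2] -/
theorem getVert_sub_mem_saws (γ : DomainSAW unitDisk δ u v) :
    (fun i => γ.walk.getVert i - u) ∈ Zd.saws 2 γ.length := by
  rw [Zd.mem_saws]
  refine ⟨by simp, fun i hi => ?_, fun i hi => ?_, fun i hi j hj hij => ?_⟩
  · show γ.walk.getVert i - u = γ.walk.getVert γ.walk.length - u
    rw [γ.walk.getVert_of_length_le hi, γ.walk.getVert_of_length_le le_rfl]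
  · rw [Zd.zdGraph_adj_sub_right]
    exact (discreteDomainGraph_unitDisk_adj.1 (γ.walk.adj_getVert_succ hi)).1
  · have h := γ.isPath.getVert_injOn
    simp only [sub_left_inj] at hij
    exact h hi hj hij

/-- **At most `cₙ` self-avoiding walks of `𝔻_δ` of length `n` join two given sites.**
[cite: MadrasSlade1993, §1.2] -/
theorem card_filter_length_eq_le_count [Fintype (DomainSAW unitDisk δ u v)] (n : ℕ) :
    ((Finset.univ : Finset (DomainSAW unitDisk δ u v)).filter (fun γ => γ.length = n)).card ≤
      Zd.count 2 n := by
  classical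
  rw [← Zd.card_saws]
  refine Finset.card_le_card_of_injOn (fun γ i => γ.walk.getVert i - u) (fun γ hγ => ?_)
    (fun γ _ γ' _ h => ?_)
  · rw [Finset.mem_coe, Finset.mem_filter] at hγ
    rw [Finset.mem_coe, ← hγ.2]
    exact getVert_sub_mem_saws γ
  · apply DomainSAW.ext_walk
    apply SimpleGraph.Walk.ext_getVert
    intro i
    have := congrFun h i
    simpa only [sub_left_inj] using this

end Counting

/-! ### The weight of the long walks -/

section Weight

variable {δ : ℝ} {u v : Site 2}

/-- **Weight of the long walks.** If `cₙ xⁿ ≤ K ρⁿ` for all `n` (`0 ≤ x`, `0 ≤ K`, `0 ≤ ρ < 1`),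
then the walks of `𝔻_δ` of length `≥ N` from `u ∈ 𝔻_δ` to `v` have total fugacity-`x` weight at
most `K ρᴺ / (1 - ρ)`. [cite: MadrasSlade1993, §1.2] -/
theorem weightAt_length_ge_le (hδ : 0 < δ) (hu : u ∈ meshDomain unitDisk δ) {x K ρ : ℝ}
    (hx : 0 ≤ x) (hK : 0 ≤ K) (hρ0 : 0 ≤ ρ) (hρ1 : ρ < 1)
    (hb : ∀ n, (Zd.count 2 n : ℝ) * x ^ n ≤ K * ρ ^ n) (N : ℕ) :
    weightAt x unitDisk δ u v {γ | N ≤ γ.length} ≤ ENNReal.ofReal (K * ρ ^ N / (1 - ρ)) := by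
  classical
  haveI := finite_domainSAW (v := v) hδ hu
  haveI : Fintype (DomainSAW unitDisk δ u v) := Fintype.ofFinite _
  rw [weightAt_apply_eq_sum, ← ENNReal.ofReal_sum_of_nonneg fun γ _ => pow_nonneg hx _]
  refine ENNReal.ofReal_le_ofReal ?_
  set F := (Finset.univ : Finset (DomainSAW unitDisk δ u v)).filter
    (· ∈ ({γ | N ≤ γ.length} : Set (DomainSAW unitDisk δ u v))) with hF
  -- an upper bound `S` for all lengths, and the fibrewise decomposition over `n ∈ [N, S]`
  set S : ℕ := F.sup fun γ => γ.length with hS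
  have hmaps : ∀ γ ∈ F, γ.length ∈ Finset.Ico N (S + 1) := fun γ hγ => by
    rw [Finset.mem_Ico]
    refine ⟨?_, Nat.lt_succ_of_le (Finset.le_sup (f := fun γ => γ.length) hγ)⟩
    have := (Finset.mem_filter.1 hγ).2
    exact this
  rw [← Finset.sum_fiberwise_of_maps_to hmaps]
  calc ∑ n ∈ Finset.Ico N (S + 1), ∑ γ ∈ F with γ.length = n, x ^ γ.length
      = ∑ n ∈ Finset.Ico N (S + 1), ((F.filter fun γ => γ.length = n).card : ℝ) * x ^ n := by
        refine Finset.sum_congr rfl fun n _ => ?_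
        rw [Finset.sum_congr rfl fun γ hγ => by rw [(Finset.mem_filter.1 hγ).2], Finset.sum_const,
          nsmul_eq_mul]
    _ ≤ ∑ n ∈ Finset.Ico N (S + 1), K * ρ ^ n := by
        refine Finset.sum_le_sum fun n _ => ?_
        have hcard : ((F.filter fun γ => γ.length = n).card : ℝ) ≤ Zd.count 2 n := by
          have h1 : (F.filter fun γ => γ.length = n).card ≤
              ((Finset.univ : Finset (DomainSAW unitDisk δ u v)).filter fun γ => γ.length = n).card :=
            Finset.card_le_card (Finset.filter_subset_filter _ (Finset.filter_subset _ _))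
          exact_mod_cast h1.trans (card_filter_length_eq_le_count n)
        calc ((F.filter fun γ => γ.length = n).card : ℝ) * x ^ n ≤ (Zd.count 2 n : ℝ) * x ^ n :=
              mul_le_mul_of_nonneg_right hcard (pow_nonneg hx _)
          _ ≤ K * ρ ^ n := hb n
    _ = K * ∑ n ∈ Finset.Ico N (S + 1), ρ ^ n := by rw [Finset.mul_sum]
    _ ≤ K * (ρ ^ N / (1 - ρ)) := mul_le_mul_of_nonneg_left (geom_sum_Ico_le_of_lt_one hρ0 hρ1) hK
    _ = K * ρ ^ N / (1 - ρ) := by ring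

/-- The `ℓ¹` norm of a site of `𝔻_δ` is `< 2/δ`. [folklore] -/
theorem l1Dist_zero_lt (hδ : 0 < δ) (hu : u ∈ meshDomain unitDisk δ) : (l1Dist 2 u 0 : ℝ) < 2 / δ := by
  have h : ∀ i : Fin 2, (((u i - (0 : Site 2) i).natAbs : ℕ) : ℝ) < 1 / δ := fun i => by
    have h1 := abs_lt_of_mem_meshDomain_unitDisk hδ hu i
    have h2 : (((u i - (0 : Site 2) i).natAbs : ℕ) : ℝ) = |((u i : ℤ) : ℝ)| := by
      rw [Pi.zero_apply, sub_zero, Nat.cast_natAbs, Int.cast_abs]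
    rwa [h2]
  have h0 := h 0
  have h1 := h 1
  simp only [l1Dist, Fin.sum_univ_two]
  push_cast
  have : (1 : ℝ) / δ + 1 / δ = 2 / δ := by ring
  linarith

/-- A site of `𝔻_δ` is joined to the centre `0` in `𝔻_δ` at graph distance at most its `ℓ¹`
norm (the coordinate box spanned by the site and `0` lies in the disk). [folklore] -/
theorem reachable_zero_and_dist_le (hu : u ∈ meshDomain unitDisk δ) :
    (discreteDomainGraph unitDisk δ).Reachable u 0 ∧
      (discreteDomainGraph unitDisk δ).dist u 0 ≤ l1Dist 2 u 0 := by
  refine reachable_and_dist_le_of_box 0 _ u rfl fun c hc => mem_meshDomain_unitDisk_of_abs_le hu fun i => ?_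
  obtain ⟨h1, h2⟩ := hc i
  simp only [Pi.zero_apply] at h1 h2
  rw [abs_le]
  constructor
  · rcases le_or_gt (u i) 0 with h | h
    · rw [min_eq_left h] at h1
      have : -|u i| ≤ u i := neg_abs_le _
      linarith
    · have : -|u i| ≤ 0 := by simp
      rw [min_eq_right h.le] at h1
      linarith
  · rcases le_or_gt (u i) 0 with h | h
    · rw [max_eq_right h] at h2
      exact h2.trans (abs_nonneg _)
    · rw [max_eq_left h.le] at h2
      exact h2.trans (le_abs_self _)

/-- **A short reference walk**: two sites of `𝔻_δ` are joined by a SAW of `𝔻_δ` of length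
`< 4/δ` (through the centre). [folklore] -/
theorem exists_domainSAW_length_le (hδ : 0 < δ) (hu : u ∈ meshDomain unitDisk δ)
    (hv : v ∈ meshDomain unitDisk δ) : ∃ γ : DomainSAW unitDisk δ u v, (γ.length : ℝ) ≤ 4 / δ := by
  classical
  obtain ⟨hru, hdu⟩ := reachable_zero_and_dist_le (δ := δ) hu
  obtain ⟨hrv, hdv⟩ := reachable_zero_and_dist_le (δ := δ) hv
  obtain ⟨p, hp⟩ := hru.exists_walk_length_eq_dist
  obtain ⟨q, hq⟩ := hrv.exists_walk_length_eq_dist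
  refine ⟨⟨(p.append q.reverse).bypass, SimpleGraph.Walk.bypass_isPath _⟩, ?_⟩
  have hlen : ((p.append q.reverse).bypass.length : ℝ) ≤ p.length + q.length := by
    have h1 := (p.append q.reverse).length_bypass_le_length
    rw [SimpleGraph.Walk.length_append, SimpleGraph.Walk.length_reverse] at h1
    exact_mod_cast h1
  have hp' : (p.length : ℝ) ≤ l1Dist 2 u 0 := by rw [hp]; exact_mod_cast hdu
  have hq' : (q.length : ℝ) ≤ l1Dist 2 v 0 := by rw [hq]; exact_mod_cast hdv
  have h1 := l1Dist_zero_lt hδ hu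
  have h2 := l1Dist_zero_lt hδ hv
  show ((p.append q.reverse).bypass.length : ℝ) ≤ 4 / δ
  have : (2 : ℝ) / δ + 2 / δ = 4 / δ := by ring
  linarith

/-- The weight of a single SAW is `x^{|γ|}` (`x ≥ 0`), so `Z ≥ x^{|γ|}` for every SAW `γ`.
[cite: DuminilCopinKozmaYadin2014, §1 (definition of P_{(Ω_δ,a_δ,b_δ,x)})] -/
theorem ofReal_pow_length_le_weightAt_univ {Ω : Set ℂ} {a b : Site 2} (x : ℝ) (γ : DomainSAW Ω δ a b) :
    ENNReal.ofReal (x ^ γ.length) ≤ weightAt x Ω δ a b Set.univ := by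
  have h : weightAt x Ω δ a b {γ} = ENNReal.ofReal (x ^ γ.length) := by
    rw [weightAt, Measure.sum_apply _ MeasurableSpace.measurableSet_top, tsum_eq_single γ]
    · simp
    · intro γ' hγ'
      simp [hγ']
  rw [← h]
  exact measure_mono (Set.subset_univ _)

/-- **`Z ≥ x^{4/δ}`** for `0 < x ≤ 1` and endpoints in `𝔻_δ`. [folklore] -/
theorem ofReal_rpow_le_weightAt_univ (hδ : 0 < δ) (hu : u ∈ meshDomain unitDisk δ)
    (hv : v ∈ meshDomain unitDisk δ) {x : ℝ} (hx0 : 0 < x) (hx1 : x ≤ 1) :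
    ENNReal.ofReal (x ^ (4 / δ)) ≤ weightAt x unitDisk δ u v Set.univ := by
  obtain ⟨γ, hγ⟩ := exists_domainSAW_length_le hδ hu hv
  refine le_trans (ENNReal.ofReal_le_ofReal ?_) (ofReal_pow_length_le_weightAt_univ x γ)
  rw [← Real.rpow_natCast]
  exact Real.rpow_le_rpow_of_exponent_ge hx0 hx1 hγ

end Weight

/-! ### Subcritical walks are short -/

section Short

variable {δ : ℝ} {u v : Site 2}

/-- For `0 < x < x_c`: `cₙ xⁿ ≤ K ρⁿ` with `K ≥ 0`, `0 < ρ < 1` (compare with the midpoint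
`w = (x + x_c)/2 < x_c`, for which `cₙ wⁿ` is bounded, `Zd.exists_bound_count_mul_pow`).
[cite: MadrasSlade1993, §1.2] -/
theorem exists_geometric_bound_count {x : ℝ} (hx0 : 0 < x) (hxc : x < criticalFugacity) :
    ∃ K ρ : ℝ, 0 ≤ K ∧ 0 < ρ ∧ ρ < 1 ∧ ∀ n, (Zd.count 2 n : ℝ) * x ^ n ≤ K * ρ ^ n := by
  set w := (x + criticalFugacity) / 2 with hw_def
  have hw : x < w := by rw [hw_def]; linarith
  have hwc : w < Zd.criticalPoint 2 := by
    show w < criticalFugacity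
    rw [hw_def]; linarith
  have hw0 : 0 < w := hx0.trans hw
  obtain ⟨K, hK⟩ := Zd.exists_bound_count_mul_pow hw0 hwc
  have hK0 : 0 ≤ K := le_trans (by positivity) (hK 0)
  refine ⟨K, x / w, hK0, div_pos hx0 hw0, (div_lt_one hw0).2 hw, fun n => ?_⟩
  have hxw : x = w * (x / w) := by field_simp
  calc (Zd.count 2 n : ℝ) * x ^ n = (Zd.count 2 n : ℝ) * w ^ n * (x / w) ^ n := by
        conv_lhs => rw [hxw]
        rw [mul_pow, mul_assoc]
    _ ≤ K * (x / w) ^ n := mul_le_mul_of_nonneg_right (hK n) (by positivity)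

/-- `x_c ≤ 1` (`μ ≥ 1`). [cite: MadrasSlade1993, §1.2] -/
theorem criticalFugacity_le_one : criticalFugacity ≤ 1 := by
  show (Zd.connectiveConstant 2)⁻¹ ≤ 1
  exact inv_le_one_of_one_le₀ (Zd.one_le_connectiveConstant 2)

/-- **The tail bound at one mesh.** For `0 < x ≤ 1` with `cₙ xⁿ ≤ K ρⁿ` (`0 < ρ < 1`) and
endpoints in `𝔻_δ`: `P_{(𝔻_δ,u,v,x)}[|γ| ≥ N] ≤ (K/(1-ρ)) ρᴺ x^{-4/δ}`. [cite: MadrasSlade1993, §1.2] -/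
theorem lawAt_length_ge_le (hδ : 0 < δ) (hu : u ∈ meshDomain unitDisk δ) (hv : v ∈ meshDomain unitDisk δ)
    {x K ρ : ℝ} (hx0 : 0 < x) (hx1 : x ≤ 1) (hK : 0 ≤ K) (hρ0 : 0 < ρ) (hρ1 : ρ < 1)
    (hb : ∀ n, (Zd.count 2 n : ℝ) * x ^ n ≤ K * ρ ^ n) (N : ℕ) :
    lawAt x unitDisk δ u v {γ | N ≤ γ.length} ≤
      ENNReal.ofReal (K / (1 - ρ) * ρ ^ N * (x ^ (4 / δ))⁻¹) := by
  have hZ := ofReal_rpow_le_weightAt_univ hδ hu hv hx0 hx1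
  have hW := weightAt_length_ge_le (v := v) hδ hu hx0.le hK hρ0.le hρ1 hb N
  have hxpow : 0 < x ^ (4 / δ) := Real.rpow_pos_of_pos hx0 _
  apply lawAt_le_of_weightAt_le
  calc weightAt x unitDisk δ u v {γ | N ≤ γ.length} ≤ ENNReal.ofReal (K * ρ ^ N / (1 - ρ)) := hW
    _ = ENNReal.ofReal (K / (1 - ρ) * ρ ^ N * (x ^ (4 / δ))⁻¹) * ENNReal.ofReal (x ^ (4 / δ)) := by
        rw [← ENNReal.ofReal_mul (by
          have : 0 < 1 - ρ := by linarith
          positivity)]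
        congr 1
        field_simp
    _ ≤ ENNReal.ofReal (K / (1 - ρ) * ρ ^ N * (x ^ (4 / δ))⁻¹) * weightAt x unitDisk δ u v Set.univ := by
        gcongr

/-- **Subcritical self-avoiding walks are short.** For `0 < x < x_c = 1/μ` there is a constant
`C = C(x) > 0` such that for every choice of endpoints `u_δ, v_δ ∈ 𝔻_δ` the fugacity-`x` SAW of
the unit disk has more than `C/δ` steps with probability `→ 0` as `δ → 0⁺` (exponentially:
`≤ (K/(1-ρ)) e^{-c/δ}`). The subcritical walk has bounded macroscopic length, the first step of
the "geodesic" picture of the source ("When `x < 1/μ`: `γ_δ` converges to a deterministic curve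
corresponding to the geodesic between `a` and `b`"). [cite: DuminilCopinKozmaYadin2014, §1 (When x < 1/μ)] -/
theorem tendsto_lawAt_length_lt_of_lt_criticalFugacity {x : ℝ} (hx0 : 0 < x) (hxc : x < criticalFugacity)
    {A B : ℝ → Site 2} (hAB : ∀ δ : ℝ, 0 < δ → A δ ∈ meshDomain unitDisk δ ∧ B δ ∈ meshDomain unitDisk δ) :
    ∃ C : ℝ, 0 < C ∧
      Tendsto (fun δ : ℝ => lawAt x unitDisk δ (A δ) (B δ) {γ | C / δ < γ.length}) (𝓝[>] 0) (𝓝 0) := by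
  have hx1 : x ≤ 1 := (hxc.le.trans criticalFugacity_le_one)
  obtain ⟨K, ρ, hK, hρ0, hρ1, hb⟩ := exists_geometric_bound_count hx0 hxc
  -- the constants: `C log(1/ρ) - 4 log(1/x) = log(1/ρ) > 0`
  set Lρ : ℝ := Real.log (1 / ρ) with hLρ
  set Lx : ℝ := Real.log (1 / x) with hLx
  have hLρ0 : 0 < Lρ := Real.log_pos (by rw [lt_div_iff₀ hρ0]; linarith)
  have hLx0 : 0 ≤ Lx := Real.log_nonneg (by rw [le_div_iff₀ hx0]; linarith)
  set C : ℝ := 4 * Lx / Lρ + 1 with hC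
  have hC0 : 0 < C := by positivity
  set c : ℝ := C * Lρ - 4 * Lx with hc
  have hc0 : 0 < c := by
    have : C * Lρ = 4 * Lx + Lρ := by rw [hC]; field_simp
    rw [hc, this]; linarith
  refine ⟨C, hC0, ?_⟩
  -- the dominating function `(K/(1-ρ)) e^{-c/δ} → 0`
  have hdom : Tendsto (fun δ : ℝ => ENNReal.ofReal (K / (1 - ρ) * Real.exp (-(c * δ⁻¹))))
      (𝓝[>] 0) (𝓝 0) := by
    have h1 : Tendsto (fun δ : ℝ => c * δ⁻¹) (𝓝[>] 0) atTop :=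
      Tendsto.const_mul_atTop hc0 tendsto_inv_nhdsGT_zero
    have h2 : Tendsto (fun δ : ℝ => Real.exp (-(c * δ⁻¹))) (𝓝[>] 0) (𝓝 0) :=
      Real.tendsto_exp_neg_atTop_nhds_zero.comp h1
    have h3 : Tendsto (fun δ : ℝ => K / (1 - ρ) * Real.exp (-(c * δ⁻¹))) (𝓝[>] 0) (𝓝 0) := by
      simpa using h2.const_mul (K / (1 - ρ))
    have h4 := (ENNReal.tendsto_ofReal h3)
    rwa [ENNReal.ofReal_zero] at h4
  refine tendsto_of_tendsto_of_tendsto_of_le_of_le' tendsto_const_nhds hdom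
    (Eventually.of_forall fun δ => by simp) ?_
  filter_upwards [self_mem_nhdsWithin] with δ hδ
  have hδ' : (0 : ℝ) < δ := hδ
  obtain ⟨hu, hv⟩ := hAB δ hδ'
  set N : ℕ := ⌈C / δ⌉₊ with hN
  -- `{C/δ < |γ|} ⊆ {N ≤ |γ|}`
  have hsub : {γ : DomainSAW unitDisk δ (A δ) (B δ) | C / δ < γ.length} ⊆ {γ | N ≤ γ.length} :=
    fun γ hγ => Nat.ceil_le.2 (le_of_lt hγ)
  refine (measure_mono hsub).trans ((lawAt_length_ge_le hδ' hu hv hx0 hx1 hK hρ0 hρ1 hb N).trans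
    (ENNReal.ofReal_le_ofReal ?_))
  have h1ρ : 0 < 1 - ρ := by linarith
  have hKρ : 0 ≤ K / (1 - ρ) := div_nonneg hK h1ρ.le
  rw [mul_assoc]
  refine mul_le_mul_of_nonneg_left ?_ hKρ
  -- `ρ^N x^{-4/δ} ≤ ρ^{C/δ} x^{-4/δ} = exp(-(C Lρ - 4 Lx)/δ)`
  have hρN : ρ ^ N ≤ ρ ^ (C / δ) := by
    rw [← Real.rpow_natCast]
    exact Real.rpow_le_rpow_of_exponent_ge hρ0 hρ1.le (Nat.le_ceil _)
  have hxpow : 0 < x ^ (4 / δ) := Real.rpow_pos_of_pos hx0 _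
  calc ρ ^ N * (x ^ (4 / δ))⁻¹ ≤ ρ ^ (C / δ) * (x ^ (4 / δ))⁻¹ :=
        mul_le_mul_of_nonneg_right hρN (inv_nonneg.2 hxpow.le)
    _ = Real.exp (-(c * δ⁻¹)) := by
        rw [Real.rpow_def_of_pos hρ0, Real.rpow_def_of_pos hx0, ← Real.exp_neg, ← Real.exp_add]
        congr 1
        have hρ' : Real.log ρ = -Lρ := by rw [hLρ, one_div, Real.log_inv, neg_neg]
        have hx' : Real.log x = -Lx := by rw [hLx, one_div, Real.log_inv, neg_neg]
        rw [hρ', hx', hc]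
        field_simp
        ring

end Short

/-! ### Short walks are thin: the tube volume of a lattice polyline -/

section Thin

variable {Ω : Set ℂ} {δ : ℝ} {a b : Site 2}

/-- Along a walk of `Ω_δ`, the mesh points of the `i`-th and `(i+m)`-th vertices are at distance
`≤ m δ`. [folklore] -/
theorem dist_meshPoint_getVert_le (hδ : 0 ≤ δ) (p : (discreteDomainGraph Ω δ).Walk a b) (i m : ℕ) :
    dist (meshPoint δ (p.getVert i)) (meshPoint δ (p.getVert (i + m))) ≤ δ * m := by
  induction m with
  | zero => simp
  | succ m ih =>
    have hstep : dist (meshPoint δ (p.getVert (i + m))) (meshPoint δ (p.getVert (i + m + 1))) ≤ δ := by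
      rcases lt_or_ge (i + m) p.length with h | h
      · have hadj := p.adj_getVert_succ h
        rw [dist_meshPoint_of_zdGraph_adj hδ
          (meshGraph_le_zdGraph Ω δ (discreteDomainGraph_le_meshGraph Ω δ hadj))]
      · rw [p.getVert_of_length_le h, p.getVert_of_length_le (by omega), dist_self]
        exact hδ
    calc dist (meshPoint δ (p.getVert i)) (meshPoint δ (p.getVert (i + (m + 1))))
        ≤ dist (meshPoint δ (p.getVert i)) (meshPoint δ (p.getVert (i + m))) +
            dist (meshPoint δ (p.getVert (i + m))) (meshPoint δ (p.getVert (i + m + 1))) := by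
          rw [← add_assoc]; exact dist_triangle _ _ _
      _ ≤ δ * m + δ := add_le_add ih hstep
      _ = δ * (m + 1 : ℕ) := by push_cast; ring

/-- **Thinning the vertices.** The trace of the polyline of a SAW `γ` of `Ω_δ` lies within
distance `k δ` of the mesh points of the vertices `γ(kj)`, `0 ≤ j ≤ |γ|/k` (`k ≥ 1`, `δ ≥ 0`).
[folklore] -/
theorem range_curve_subset_iUnion_closedBall_getVert (hδ : 0 ≤ δ) (γ : DomainSAW Ω δ a b) {k : ℕ}
    (hk : 0 < k) :
    γ.curve.range ⊆ ⋃ j ∈ Finset.range (γ.length / k + 1),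
      closedBall (meshPoint δ (γ.walk.getVert (k * j))) (k * δ) := by
  intro q hq
  obtain ⟨w, hw, hqw⟩ := mem_iUnion₂.1 (range_curve_subset_iUnion_closedBall hδ γ hq)
  obtain ⟨i, rfl, hi⟩ := SimpleGraph.Walk.mem_support_iff_exists_getVert.1 hw
  refine mem_iUnion₂.2 ⟨i / k, Finset.mem_range.2 (Nat.lt_succ_of_le (Nat.div_le_div_right hi)), ?_⟩
  rw [mem_closedBall] at hqw ⊢
  have hnear : dist (meshPoint δ (γ.walk.getVert (k * (i / k)))) (meshPoint δ (γ.walk.getVert i)) ≤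
      δ * (i % k : ℕ) := by
    have h := dist_meshPoint_getVert_le hδ γ.walk (k * (i / k)) (i % k)
    rwa [Nat.div_add_mod] at h
  have hmod : ((i % k : ℕ) : ℝ) ≤ k - 1 := by
    have h := Nat.mod_lt i hk
    have : (i % k : ℕ) + 1 ≤ k := h
    have h' : ((i % k : ℕ) : ℝ) + 1 ≤ k := by exact_mod_cast this
    linarith
  calc dist q (meshPoint δ (γ.walk.getVert (k * (i / k))))
      ≤ dist q (meshPoint δ (γ.walk.getVert i)) +
          dist (meshPoint δ (γ.walk.getVert i)) (meshPoint δ (γ.walk.getVert (k * (i / k)))) :=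
        dist_triangle _ _ _
    _ ≤ δ + δ * (k - 1) := by
        rw [dist_comm (meshPoint δ (γ.walk.getVert i))]
        exact add_le_add hqw (hnear.trans (mul_le_mul_of_nonneg_left hmod hδ))
    _ = k * δ := by ring

/-- **The tube volume of a lattice polyline**: for a SAW `γ` of `Ω_δ`, `k ≥ 1` and any `ρ`,
`vol{w : dist(w, trace γ) < ρ} ≤ (|γ|/k + 1) · π (kδ + ρ)²`. [folklore] -/
theorem volume_setOf_infDist_lt_le (hδ : 0 ≤ δ) (γ : DomainSAW Ω δ a b) {k : ℕ} (hk : 0 < k)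
    (ρ : ℝ) :
    volume {w : ℂ | infDist w γ.curve.range < ρ} ≤
      ((γ.length / k + 1 : ℕ) : ℝ≥0∞) * (ENNReal.ofReal (k * δ + ρ) ^ 2 * NNReal.pi) := by
  have hsub : {w : ℂ | infDist w γ.curve.range < ρ} ⊆ ⋃ j ∈ Finset.range (γ.length / k + 1),
      ball (meshPoint δ (γ.walk.getVert (k * j))) (k * δ + ρ) := by
    intro w hw
    rw [mem_setOf_eq, infDist_lt_iff γ.curve.range_nonempty] at hw
    obtain ⟨q, hq, hwq⟩ := hw
    obtain ⟨j, hj, hqj⟩ := mem_iUnion₂.1 (range_curve_subset_iUnion_closedBall_getVert hδ γ hk hq)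
    refine mem_iUnion₂.2 ⟨j, hj, mem_ball.2 ?_⟩
    rw [mem_closedBall] at hqj
    calc dist w (meshPoint δ (γ.walk.getVert (k * j)))
        ≤ dist w q + dist q (meshPoint δ (γ.walk.getVert (k * j))) := dist_triangle _ _ _
      _ < ρ + k * δ := add_lt_add_of_lt_of_le hwq hqj
      _ = k * δ + ρ := add_comm _ _
  calc volume {w : ℂ | infDist w γ.curve.range < ρ}
      ≤ volume (⋃ j ∈ Finset.range (γ.length / k + 1),
          ball (meshPoint δ (γ.walk.getVert (k * j))) (k * δ + ρ)) := measure_mono hsub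
    _ ≤ ∑ j ∈ Finset.range (γ.length / k + 1),
          volume (ball (meshPoint δ (γ.walk.getVert (k * j))) (k * δ + ρ)) :=
        measure_biUnion_finset_le _ _
    _ = ∑ _j ∈ Finset.range (γ.length / k + 1), ENNReal.ofReal (k * δ + ρ) ^ 2 * (NNReal.pi : ℝ≥0∞) :=
        Finset.sum_congr rfl fun j _ => Complex.volume_ball _ _
    _ = ((γ.length / k + 1 : ℕ) : ℝ≥0∞) * (ENNReal.ofReal (k * δ + ρ) ^ 2 * NNReal.pi) := by
        rw [Finset.sum_const, Finset.card_range, nsmul_eq_mul]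

/-- **Short walks are thin.** A SAW of `Ω_δ` with at most `C/δ` steps has
`vol{w : dist(w, trace γ) < ρ} ≤ 9π(C+1)ρ` whenever `0 < δ ≤ ρ ≤ 1` (take `k = ⌈ρ/δ⌉`: at most
`C/ρ + 1` balls of radius `kδ + ρ ≤ 3ρ`). [folklore] -/
theorem volume_setOf_infDist_lt_le_of_length_le {C ρ : ℝ} (hδ : 0 < δ) (hδρ : δ ≤ ρ) (hρ1 : ρ ≤ 1)
    (hC : 0 ≤ C) (γ : DomainSAW Ω δ a b) (hγ : (γ.length : ℝ) ≤ C / δ) :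
    volume {w : ℂ | infDist w γ.curve.range < ρ} ≤ ENNReal.ofReal (9 * Real.pi * (C + 1) * ρ) := by
  have hρ : 0 < ρ := hδ.trans_le hδρ
  set k : ℕ := ⌈ρ / δ⌉₊ with hk
  have hk1 : (ρ / δ : ℝ) ≤ k := Nat.le_ceil _
  have hρδ1 : 1 ≤ ρ / δ := by rwa [le_div_iff₀ hδ, one_mul]
  have hk0 : 0 < k := by
    have : (0 : ℝ) < k := lt_of_lt_of_le (by linarith) hk1
    exact_mod_cast this
  have hkδ : (k : ℝ) * δ ≤ 2 * ρ := by
    have h1 : (k : ℝ) < ρ / δ + 1 := Nat.ceil_lt_add_one (by positivity)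
    have h2 : (k : ℝ) * δ ≤ (ρ / δ + 1) * δ := mul_le_mul_of_nonneg_right h1.le hδ.le
    have h3 : (ρ / δ + 1) * δ = ρ + δ := by field_simp
    linarith
  refine (volume_setOf_infDist_lt_le hδ.le γ hk0 ρ).trans ?_
  -- `(|γ|/k + 1) ≤ C/ρ + 1` and `(kδ + ρ)² π ≤ 9 ρ² π`
  have hcount : (((γ.length / k + 1 : ℕ) : ℝ≥0∞)) ≤ ENNReal.ofReal (C / ρ + 1) := by
    have h1 : ((γ.length / k : ℕ) : ℝ) ≤ (γ.length : ℝ) / k := Nat.cast_div_le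
    have hkpos : (0 : ℝ) < k := by exact_mod_cast hk0
    have h2 : (γ.length : ℝ) / k ≤ C / ρ := by
      rw [div_le_div_iff₀ hkpos hρ]
      calc (γ.length : ℝ) * ρ ≤ C / δ * ρ := mul_le_mul_of_nonneg_right hγ hρ.le
        _ = C * (ρ / δ) := by field_simp
        _ ≤ C * k := mul_le_mul_of_nonneg_left hk1 hC
    have h3 : ((γ.length / k + 1 : ℕ) : ℝ) ≤ C / ρ + 1 := by push_cast; linarith
    calc ((γ.length / k + 1 : ℕ) : ℝ≥0∞) = ENNReal.ofReal ((γ.length / k + 1 : ℕ) : ℝ) := by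
          rw [ENNReal.ofReal_natCast]
      _ ≤ ENNReal.ofReal (C / ρ + 1) := ENNReal.ofReal_le_ofReal h3
  have hpi : (NNReal.pi : ℝ≥0∞) = ENNReal.ofReal Real.pi := by
    rw [← ENNReal.ofReal_coe_nnreal, NNReal.coe_real_pi]
  have h3ρ : (k : ℝ) * δ + ρ ≤ 3 * ρ := by linarith
  calc ((γ.length / k + 1 : ℕ) : ℝ≥0∞) * (ENNReal.ofReal (k * δ + ρ) ^ 2 * NNReal.pi)
      ≤ ENNReal.ofReal (C / ρ + 1) * (ENNReal.ofReal (3 * ρ) ^ 2 * NNReal.pi) := by gcongr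
    _ = ENNReal.ofReal ((C / ρ + 1) * ((3 * ρ) ^ 2 * Real.pi)) := by
        rw [hpi, ← ENNReal.ofReal_pow (by positivity), ← ENNReal.ofReal_mul (by positivity),
          ← ENNReal.ofReal_mul (by positivity)]
    _ ≤ ENNReal.ofReal (9 * Real.pi * (C + 1) * ρ) := by
        refine ENNReal.ofReal_le_ofReal ?_
        have h1 : (C / ρ + 1) * ((3 * ρ) ^ 2 * Real.pi) = 9 * Real.pi * (C + ρ) * ρ := by
          field_simp
          ring
        rw [h1]
        have : C + ρ ≤ C + 1 := by linarith
        have hπ : 0 < Real.pi := Real.pi_pos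
        gcongr

end Thin

end SupercriticalSAW

end Literature.Barriers.CriticalPhenomena
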